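/-
Copyright: b2b-lace packet (enumeration shard B, gen 11).  SOUNDNESS OF THE INTERVAL FORM OF RECURSION (5.1):
rational lower/upper tables that enclose the two INPUT families `I_{0,l}(x)` (walk counts) and `I_{n,0}(x)`
(seeds) and are consistent with `I_{n+1,l+1} = I_{n+1,l} - I_{n,l}` enclose every `I_{n,l}(x)`.
d-generic; no numeral; nothing cited beyond the tree's (5.1); no `sorry`.
-/
import Literature.Probability.FitznerVanDerHofstad2017.SrwIntegralBounds
import HarnessLib

/-!
# Interval soundness of the SRW-integral recursion (5.1)

CITATION HEADER (PLACEMENT v2). This module is part of a certified REPRODUCTION of: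
R. Fitzner, R. van der Hofstad, *Mean-field behavior for nearest-neighbor percolation in d > 10*,
Electron. J. Probab. 22 (2017), no. 43, 1–65 [FvdH17], and *Generalized approach to the non-backtracking
lace expansion*, Probab. Theory Related Fields 169 (2017), 1041–1119 [NoBLE17-I] (arXiv:1506.07977, 1506.07969).
Reproduces: the way the accompanying notebook `SRW.nb` §1 fills the table `Ivalue[n,l,x] = I_{n,l}(x; d)`
([NoBLE17-I] (3.35)) from its two input families — the walk counts `I_{0,l}(x) = p_l(x)` and the Bessel
integrals `I_{n,0}(x)` — by the recursion **(5.1)** `I_{n+1,l+1}(x) = I_{n+1,l}(x) - I_{n,l}(x)` of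
[NoBLE17-I] §5.1 (tree: `srwI_succ_succ`), here in INTERVAL form: the soundness statement that turns two
enclosed input families plus recursion-consistent rational tables into an enclosure of the whole table.
Origin: build `lace`, GAPS G8 (δ) SPEC v1 item (δ2)(ii) ("every `Ivalue` entry re-derived from certified
seeds by (5.1) in exact/interval arithmetic"), enumeration shard B (enum2-g11).

## What is here

* `srwI_encl_of_tables` — for `2N + 1 ≤ d`, rational tables `lo hi : ℕ → ℕ → ℚ` with
  (h0) `lo 0 l ≤ I_{0,l}(x) ≤ hi 0 l` (`l ≤ L`), (hs) `lo n 0 ≤ I_{n,0}(x) ≤ hi n 0` (`1 ≤ n ≤ N`) and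
  (hr) `lo (n+1) (l+1) ≤ lo (n+1) l - hi n l`, `hi (n+1) l - lo n l ≤ hi (n+1) (l+1)` (`n < N`, `l < L`)
  satisfy `lo n l ≤ I_{n,l}(x) ≤ hi n l` for all `n ≤ N`, `l ≤ L` (induction on `l` through (5.1));
* `srwI_mem_ball_of_tables` — the same with the conclusion as a ball `|I_{n,l}(x) - (lo+hi)/2| ≤ (hi-lo)/2`.
The hypotheses (h0), (hr) are decidable once the tables are computable rationals (they are discharged by
`decide +kernel` in the instance files); (hs) is what a seed certificate delivers.

## What is NOT here
No table, no seed, no walk count, no dimension; no cited fact, no named hypothesis.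

## References
* [NoBLE17-I] R. Fitzner, R. van der Hofstad, PTRF 169 (2017) 1041–1119; arXiv:1506.07969 — (3.35) p. 1071,
  (5.1) p. 1090; notebook `SRW.nb` §1 (arXiv:1506.07977 anc).
-/

namespace Literature.Probability.FitznerVanDerHofstad2017

variable {d : ℕ}

/-- **Interval soundness of (5.1).**  Let `2N + 1 ≤ d` and let `lo hi : ℕ → ℕ → ℚ` be tables such that
(h0) the `n = 0` row encloses the walk-count integrals `I_{0,l}(x)`, `l ≤ L`; (hs) the `l = 0` column encloses
the seeds `I_{n,0}(x)`, `1 ≤ n ≤ N`; (hr) the tables are consistent with the recursion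
`I_{n+1,l+1} = I_{n+1,l} - I_{n,l}` in interval arithmetic.  Then `lo n l ≤ I_{n,l}(x) ≤ hi n l` for all
`n ≤ N`, `l ≤ L`. [cite: FitznerVanDerHofstad2016NoBLE, (5.1) p. 1090] -/
theorem srwI_encl_of_tables {N L : ℕ} (hd : 2 * N + 1 ≤ d) (x : Fin d → ℤ) (lo hi : ℕ → ℕ → ℚ)
    (h0 : ∀ l ≤ L, ((lo 0 l : ℚ) : ℝ) ≤ srwI d 0 l x ∧ srwI d 0 l x ≤ ((hi 0 l : ℚ) : ℝ))
    (hs : ∀ n, 1 ≤ n → n ≤ N → ((lo n 0 : ℚ) : ℝ) ≤ srwI d n 0 x ∧ srwI d n 0 x ≤ ((hi n 0 : ℚ) : ℝ))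
    (hr : ∀ n < N, ∀ l < L,
      lo (n + 1) (l + 1) ≤ lo (n + 1) l - hi n l ∧ hi (n + 1) l - lo n l ≤ hi (n + 1) (l + 1)) :
    ∀ n ≤ N, ∀ l ≤ L, ((lo n l : ℚ) : ℝ) ≤ srwI d n l x ∧ srwI d n l x ≤ ((hi n l : ℚ) : ℝ) := by
  suffices key : ∀ l ≤ L, ∀ n ≤ N, ((lo n l : ℚ) : ℝ) ≤ srwI d n l x ∧ srwI d n l x ≤ ((hi n l : ℚ) : ℝ) from
    fun n hn l hl => key l hl n hn
  intro l
  induction l with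
  | zero =>
      intro _ n hn
      rcases Nat.eq_zero_or_pos n with rfl | hpos
      · exact h0 0 (Nat.zero_le L)
      · exact hs n hpos hn
  | succ l ih =>
      intro hl n hn
      rcases Nat.eq_zero_or_pos n with rfl | hpos
      · exact h0 (l + 1) hl
      · obtain ⟨n, rfl⟩ : ∃ k, n = k + 1 := ⟨n - 1, by omega⟩
        have hl' : l ≤ L := Nat.le_of_succ_le hl
        have hrec := srwI_succ_succ (d := d) (n := n) (by omega) l x
        have h1 := ih hl' (n + 1) hn
        have h2 := ih hl' n (Nat.le_of_succ_le hn)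
        have h3 := hr n (by omega) l (by omega)
        have h3a : ((lo (n + 1) (l + 1) : ℚ) : ℝ) ≤ ((lo (n + 1) l : ℚ) : ℝ) - ((hi n l : ℚ) : ℝ) := by
          exact_mod_cast h3.1
        have h3b : ((hi (n + 1) l : ℚ) : ℝ) - ((lo n l : ℚ) : ℝ) ≤ ((hi (n + 1) (l + 1) : ℚ) : ℝ) := by
          exact_mod_cast h3.2
        rw [hrec]
        constructor <;> linarith [h1.1, h1.2, h2.1, h2.2]

/-- The same enclosure written as balls: `|I_{n,l}(x) - (lo n l + hi n l)/2| ≤ (hi n l - lo n l)/2`.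
[cite: FitznerVanDerHofstad2016NoBLE, (5.1) p. 1090] -/
theorem srwI_mem_ball_of_tables {N L : ℕ} (hd : 2 * N + 1 ≤ d) (x : Fin d → ℤ) (lo hi : ℕ → ℕ → ℚ)
    (h0 : ∀ l ≤ L, ((lo 0 l : ℚ) : ℝ) ≤ srwI d 0 l x ∧ srwI d 0 l x ≤ ((hi 0 l : ℚ) : ℝ))
    (hs : ∀ n, 1 ≤ n → n ≤ N → ((lo n 0 : ℚ) : ℝ) ≤ srwI d n 0 x ∧ srwI d n 0 x ≤ ((hi n 0 : ℚ) : ℝ))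
    (hr : ∀ n < N, ∀ l < L,
      lo (n + 1) (l + 1) ≤ lo (n + 1) l - hi n l ∧ hi (n + 1) l - lo n l ≤ hi (n + 1) (l + 1))
    {n l : ℕ} (hn : n ≤ N) (hl : l ≤ L) :
    |srwI d n l x - (((lo n l + hi n l) / 2 : ℚ) : ℝ)| ≤ (((hi n l - lo n l) / 2 : ℚ) : ℝ) := by
  have h := srwI_encl_of_tables hd x lo hi h0 hs hr n hn l hl
  push_cast
  rw [abs_le]
  constructor <;> linarith [h.1, h.2]

end Literature.Probability.FitznerVanDerHofstad2017
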